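import Summits.ABC.IUTFork.LDHSlotRegimePointNecessitySharpFree
import Summits.ABC.IUTFork.LDHEqualHeightsLocusHullRegime
import HarnessLib

/-!
# The fork at [IUTchIII] Corollary 3.12, L-DH level, READING (U): the SHARP datum-free necessity read from the REGIME binder `hreg`
# (the CONE hypothesis of the certificates of record `abc_of_S_v4` / `abc_of_SH_v6K` / `abc_of_SH_v10M`) — abc-iut cell, R2 S-chain team
# seat abc-iut-s2-p1 gen 2; crux ThetaPartII = stmt-ABC-19678

Record-only PROOF file (D-0012) of the abc-iut cell; TAKES NO SIDE on [IUTchIII] Cor. 3.12 or on the (U)/(P) readings of "−|log(Θ)|".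
Mochizuki, *Inter-universal Teichmüller theory IV* (RIMS manuscript Apr. 2020 = PRIMS **57** (2021)), Thm. 1.10 proof Step (ii) p. 24,
Step (v) pp. 27–28; Cor. 2.2 (ii) proof p. 46; Dupuy–Hilado [DupuyHilado2025] §3.3, §3.6, §4.7, §4.11–4.12.

Part 3 of this seat's `LDHSlotRegimePointNecessitySharp` (p445083) / `…SharpFree` (p445537, p446116): there the sharp necessity
«mixed bad height of `j(λ)` ≤ `O(d_mod)` conductors + print's rounding/prime slack» was read from the VOLUME binder `hvol` of `abc_of_S_v3`
(the hull estimate at EVERY genuine datum). The certificates of record since C-R13 carry instead abc-iut-c312-8's REGIME binder `hreg`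
(`Conditional/AbcOfSGenuineRegime.lean` `abc_of_S_v4`, byte-identical in `abc_of_SH_v6K` / `abc_of_SH_v10M`): the same estimate demanded only at
data whose canonical `log(q_v)` is NOT constant over some support prime. A point with a MIXED prime (a (P5)-bad place `V` and a place `W` of
different normalised height over one rational prime) has ONLY such data (abc-iut-s2-p4's `not_slotConstant_of_unequalHeightsPoint`, p437976),
so at those points `hreg` delivers the hull estimate at every datum and the whole sharp chain applies. THIS FILE records that reading:

* `PointDict.pointMixedShare_add_mulNdeg_le_of_hullEstimateOf` — ONE datum `T` with `T.HullEstimateOf δ` suffices for part 1's point inequality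
  (`… + ((l+5)/4 − d_mod)·log(𝔡^{T.K}) ≤ δ`); `PointDict.pointMixedShare_le_sub_gain_of_hullEstimateOf` — its datum-free form
  (`≤ δ − ((l+5)/4 − d_mod)·(lD + (1 − 1/l)·lC)`, abc-iut-S4's `ndeg_differentDivisor_ge`);
* **`PointDict.pointMixedShare_le_slack_of_hreg`** — from `hreg` VERBATIM: at every admissible `(λ, l)` with `4·d_mod ≤ l+5` that has a mixed pair
  `(V, W)` of places of `F_tpd` over one prime (`V` bad `∤ 2l`, `W` of different normalised `ord(j(λ))·log N/n` if bad), for every finite `W₀`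
  of primes with `ω_p > 0`: the slack inequality of `pointMixedShare_le_slack_of_hvol`;
* `PointDict.pointMixedShare_le_slack_eventually_of_hreg` — the same with (P6) discharged above a height on every compactly bounded `K_V`
  (`Cor22.condP6_of_seven_le`).

Notation as in parts 1–2 (inline, no definition): `F_mod := ℚ(j(λ)) ⊆ F_tpd`; `S(p) := Σ_{V|p (P5)-bad} Pr(V)·(−ord_V j(λ))·log N(V)/n_V`;
`ω_p :=` non-bad weight; `lD := log-diff(λ)`, `lC := logCondAvoid{2,l}`, `d := d_mod`, `d* := 2¹²·3³·5·d`. HONEST SCOPE: compositions; no datum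
constructed; nothing asserted about any point; no side taken on Cor. 3.12 / Thm. 1.10 or on any author; typed ≠ proved. PROOF-ONLY file: no
definitions, no named `Prop` facts. [cite: Mochizuki2012, IUTchIV Thm. 1.10 proof Step (ii) p. 24, Step (v) p. 27–28]
[cite: Mochizuki2012, IUTchIV Cor. 2.2 (ii) proof p. 46] [cite: DupuyHilado2025, §3.3, §3.6, §4.7, §4.12] [claim: Mochizuki2012, status: disputed]
for every IUT quotation.
-/

noncomputable section

namespace Summit.ABC.IUTFork

open NumberField IsDedekindDomain Literature.IUT.LogVolume Literature.IUT.HodgeTheaters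
open Literature.NumberTheory.DiophantineGeometry.GenEll Literature.NumberTheory.NumberFields
open scoped Classical

namespace PointDict

variable {P : NFPoint} {l : ℕ}

/-- **ONE datum suffices.** A genuine Θ-volume datum `T` at `(P, l)` with `T.HullEstimateOf δ` forces, for every finite set `W` of primes each
under a non-(P5)-bad place of `ℚ(j(λ))` of positive weight `ω_p`:
`Σ_{p∈W} (S(p)/(2l))·(l(l+1)/12 − 4(1−ω_p)/((l−1)·ω_p³)) + ((l+5)/4 − d_mod)·log(𝔡^{T.K}) ≤ δ` (part 1's
`mixedShare_add_mulNdeg_le_of_hullEstimateOf` transported by gen 0's `sum_goodWeight_eq_point` / `sum_badHeight_mul_weight_eq_point_div`).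
[cite: Mochizuki2012, IUTchIV Thm. 1.10 proof Step (v) p. 27–28] [cite: DupuyHilado2025, §3.3, §3.6, §4.7, §4.12]
[claim: Mochizuki2012, status: disputed] -/
theorem pointMixedShare_add_mulNdeg_le_of_hullEstimateOf (T : Cor22.ThetaVolumeDatumAt P l) {δ : ℝ}
    (h : T.HullEstimateOf δ) (W : Finset ℕ) (hW : ∀ p ∈ W, p.Prime)
    (hω : ∀ p ∈ W, 0 < ∑ V ∈ Finset.univ.filter
        (fun V : placesOver ↥(IntermediateField.adjoin ℚ ({Cor22.jInv P.x} : Set P.F)) p =>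
          ¬ (ord _ V.1 (Cor22.jMod P) < 0 ∧ ((2 : ℕ) : 𝓞 _) ∉ V.1.asIdeal ∧ ((l : ℕ) : 𝓞 _) ∉ V.1.asIdeal)),
        weight _ V.1) :
    ∑ p ∈ W, (1 / (2 * (l : ℝ)) * ∑ V : placesOver ↥(IntermediateField.adjoin ℚ ({Cor22.jInv P.x} : Set P.F)) p,
        (if ord _ V.1 (Cor22.jMod P) < 0 ∧ ((2 : ℕ) : 𝓞 _) ∉ V.1.asIdeal ∧ ((l : ℕ) : 𝓞 _) ∉ V.1.asIdeal then
          weight _ V.1 * (((-ord _ V.1 (Cor22.jMod P) : ℤ) : ℝ) * logNorm _ V.1 / (localDegree _ V.1 : ℝ))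
         else 0)) *
      ((l : ℝ) * ((l : ℝ) + 1) / 12
        - 4 * (1 - ∑ V ∈ Finset.univ.filter
              (fun V : placesOver ↥(IntermediateField.adjoin ℚ ({Cor22.jInv P.x} : Set P.F)) p =>
                ¬ (ord _ V.1 (Cor22.jMod P) < 0 ∧ ((2 : ℕ) : 𝓞 _) ∉ V.1.asIdeal ∧ ((l : ℕ) : 𝓞 _) ∉ V.1.asIdeal)),
              weight _ V.1) /
          (((l : ℝ) - 1) * (∑ V ∈ Finset.univ.filter
              (fun V : placesOver ↥(IntermediateField.adjoin ℚ ({Cor22.jInv P.x} : Set P.F)) p =>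
                ¬ (ord _ V.1 (Cor22.jMod P) < 0 ∧ ((2 : ℕ) : 𝓞 _) ∉ V.1.asIdeal ∧ ((l : ℕ) : 𝓞 _) ∉ V.1.asIdeal)),
              weight _ V.1) ^ 3))
      + (((l : ℝ) + 5) / 4 - Cor22.dmod P) *
        (letI := T.instFieldK; letI := T.instNumberFieldK
         ndeg T.K (differentDivisor T.K)) ≤ δ := by
  letI := T.instFieldF; letI := T.instNumberFieldF; letI := T.instAlgebraF; letI := T.instFieldK
  letI := T.instNumberFieldK; letI := T.instAlgebraK; letI := T.instFieldFbar; letI := T.instAlgebraFbar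
  letI := T.instAlgebraKFbar; letI := T.instIsElliptic
  have hω' : ∀ p ∈ W, 0 < ∑ v ∈ Finset.univ.filter
      (fun v : placesOver ↥(fieldOfModuli T.E) p => v.1 ∉ ThetaData.badPrimesMod T.D), weight ↥(fieldOfModuli T.E) v.1 := by
    intro p hp
    haveI : Fact p.Prime := ⟨hW p hp⟩
    rw [sum_goodWeight_eq_point T p]
    exact hω p hp
  have hs2 := mixedShare_add_mulNdeg_le_of_hullEstimateOf T h W hW hω'
  refine le_of_eq_of_le ?_ hs2
  congr 1
  refine Finset.sum_congr rfl fun p hp => ?_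
  haveI : Fact p.Prime := ⟨hW p hp⟩
  rw [sum_badHeight_mul_weight_eq_point_div T p, sum_goodWeight_eq_point T p]

/-- **ONE datum suffices, datum-free form**: `T.HullEstimateOf δ` at one genuine datum `T` of `(P, l)` and `4·d_mod ≤ l + 5` give
`Σ_{p∈W} (S(p)/(2l))·(l(l+1)/12 − 4(1−ω_p)/((l−1)·ω_p³)) ≤ δ − ((l+5)/4 − d_mod)·(lD + (1 − 1/l)·lC)` (abc-iut-S4's
`Cor22.ThetaVolumeDatumAt.ndeg_differentDivisor_ge`). [cite: Mochizuki2012, IUTchIV Thm. 1.10 proof Step (ii) p. 24, Step (v) p. 27–28]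
[claim: Mochizuki2012, status: disputed] -/
theorem pointMixedShare_le_sub_gain_of_hullEstimateOf (T : Cor22.ThetaVolumeDatumAt P l) {δ : ℝ}
    (h : T.HullEstimateOf δ) (hl : 0 < l) (h4d : 4 * (Cor22.dmod P : ℝ) ≤ (l : ℝ) + 5)
    (W : Finset ℕ) (hW : ∀ p ∈ W, p.Prime)
    (hω : ∀ p ∈ W, 0 < ∑ V ∈ Finset.univ.filter
        (fun V : placesOver ↥(IntermediateField.adjoin ℚ ({Cor22.jInv P.x} : Set P.F)) p =>
          ¬ (ord _ V.1 (Cor22.jMod P) < 0 ∧ ((2 : ℕ) : 𝓞 _) ∉ V.1.asIdeal ∧ ((l : ℕ) : 𝓞 _) ∉ V.1.asIdeal)),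
        weight _ V.1) :
    ∑ p ∈ W, (1 / (2 * (l : ℝ)) * ∑ V : placesOver ↥(IntermediateField.adjoin ℚ ({Cor22.jInv P.x} : Set P.F)) p,
        (if ord _ V.1 (Cor22.jMod P) < 0 ∧ ((2 : ℕ) : 𝓞 _) ∉ V.1.asIdeal ∧ ((l : ℕ) : 𝓞 _) ∉ V.1.asIdeal then
          weight _ V.1 * (((-ord _ V.1 (Cor22.jMod P) : ℤ) : ℝ) * logNorm _ V.1 / (localDegree _ V.1 : ℝ))
         else 0)) *
      ((l : ℝ) * ((l : ℝ) + 1) / 12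
        - 4 * (1 - ∑ V ∈ Finset.univ.filter
              (fun V : placesOver ↥(IntermediateField.adjoin ℚ ({Cor22.jInv P.x} : Set P.F)) p =>
                ¬ (ord _ V.1 (Cor22.jMod P) < 0 ∧ ((2 : ℕ) : 𝓞 _) ∉ V.1.asIdeal ∧ ((l : ℕ) : 𝓞 _) ∉ V.1.asIdeal)),
              weight _ V.1) /
          (((l : ℝ) - 1) * (∑ V ∈ Finset.univ.filter
              (fun V : placesOver ↥(IntermediateField.adjoin ℚ ({Cor22.jInv P.x} : Set P.F)) p =>
                ¬ (ord _ V.1 (Cor22.jMod P) < 0 ∧ ((2 : ℕ) : 𝓞 _) ∉ V.1.asIdeal ∧ ((l : ℕ) : 𝓞 _) ∉ V.1.asIdeal)),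
              weight _ V.1) ^ 3)) ≤
      δ - (((l : ℝ) + 5) / 4 - Cor22.dmod P) * (P.logDiff + (1 - 1 / (l : ℝ)) * Cor22.logCondAvoid P {2, l}) := by
  have h1 := pointMixedShare_add_mulNdeg_le_of_hullEstimateOf T h W hW hω
  have h2 := T.ndeg_differentDivisor_ge hl
  have hc : 0 ≤ ((l : ℝ) + 5) / 4 - (Cor22.dmod P : ℝ) := by linarith
  have h3 := mul_le_mul_of_nonneg_left h2 hc
  linarith

/-- Real arithmetic of the slack (as in part 2). [folklore] -/
private theorem le_slack_of_add_gain_le' {l d lD lC R δ G x : ℝ} (hl : 0 < l)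
    (hδ : δ = (l + 1) / 4 * ((1 + 12 * d / l) * (lD + lC) + R))
    (hG : lD + (1 - 1 / l) * lC ≤ G) (h4d : 4 * d ≤ l + 5) (hx : x + ((l + 5) / 4 - d) * G ≤ δ) :
    x ≤ (4 * d - 1 + 3 * d / l) * (lD + lC) + (l + 5 - 4 * d) / (4 * l) * lC + (l + 1) / 4 * R := by
  have hc : 0 ≤ (l + 5) / 4 - d := by linarith
  have h1 : ((l + 5) / 4 - d) * (lD + (1 - 1 / l) * lC) ≤ ((l + 5) / 4 - d) * G := mul_le_mul_of_nonneg_left hG hc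
  have key : (l + 1) / 4 * ((1 + 12 * d / l) * (lD + lC) + R) - ((l + 5) / 4 - d) * (lD + (1 - 1 / l) * lC)
      = (4 * d - 1 + 3 * d / l) * (lD + lC) + (l + 5 - 4 * d) / (4 * l) * lC + (l + 1) / 4 * R := by
    field_simp
    ring
  linarith [key]

/-- **SHARP NECESSITY FROM THE REGIME BINDER `hreg`, SLACK FORM.** From the CONE binder `hreg` of `abc_of_S_v4` / `abc_of_SH_v6K` /
`abc_of_SH_v10M` VERBATIM: at every admissible `(λ, l)` with `4·d_mod ≤ l + 5` possessing a MIXED PAIR — places `V, W` of `F_tpd = ℚ(λ)` over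
one rational prime `p₀` with `V` a pole of `j(λ)` dividing neither `2` nor `l` and, if `W` is one too, `ord_V(j)·log N(V)/n_V ≠ ord_W(j)·log N(W)/n_W`
(abc-iut-s2-p4's `not_slotConstant_of_unequalHeightsPoint`: then NO datum at `(λ, l)` is slot-constant, so `hreg` yields the hull estimate at every
datum; data exist by abc-iut-L5-t7's `ThetaPartII.stub_thetaData`) — and every finite set `W₀` of primes each under a non-(P5)-bad place of `ℚ(j(λ))`
of positive weight `ω_p`:
`Σ_{p∈W₀} (S(p)/(2l))·(l(l+1)/12 − 4(1−ω_p)/((l−1)·ω_p³)) ≤ (4d − 1 + 3d/l)·(lD + lC) + ((l+5−4d)/(4l))·lC + ((l+1)/4)·(2 log l + 52 + (20/3)·log(d*l)·π(d*l))`.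
Datum-free, IUT-free; nothing asserted about any point. [cite: Mochizuki2012, IUTchIV Thm. 1.10 proof Step (ii) p. 24, Step (v) p. 27–28]
[cite: Mochizuki2012, IUTchIV Cor. 2.2 (ii) proof p. 46] [claim: Mochizuki2012, status: disputed] -/
theorem pointMixedShare_le_slack_of_hreg
    (hreg : ∀ P : NFPoint, P ∈ UP → ∀ l : ℕ, l.Prime → 5 ≤ l →
      Cor22.AdmitsCore P → Cor22.CondP2 P l → Cor22.CondP5 P l → Cor22.CondP6 P l →
      ∀ T : Cor22.ThetaVolumeDatumAt P l,
        (letI := T.instFieldF; letI := T.instNumberFieldF; letI := T.instAlgebraF; letI := T.instFieldK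
         letI := T.instNumberFieldK; letI := T.instAlgebraK; letI := T.instFieldFbar; letI := T.instAlgebraFbar
         letI := T.instAlgebraKFbar; letI := T.instIsElliptic
         ¬ (∀ p ∈ T.I.supportPrimes, ∀ v w : placesOver (fieldOfModuli T.E) p,
            (Summit.ABC.IUTFork.DHData.ofInput T.I).logQloc p v = (Summit.ABC.IUTFork.DHData.ofInput T.I).logQloc p w)) →
        T.HullEstimateOf
          (((l : ℝ) + 1) / 4 *
            ((1 + 12 * (Cor22.dmod P : ℝ) / l) * (P.logDiff + Cor22.logCondAvoid P {2, l})
              + 2 * Real.log l + 52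
              + 20 / 3 * Real.log (((2 ^ 12 * 3 ^ 3 * 5 * Cor22.dmod P : ℕ) : ℝ) * (l : ℝ))
                * (Nat.primeCounting (2 ^ 12 * 3 ^ 3 * 5 * Cor22.dmod P * l) : ℝ))))
    (hP : P ∈ UP) (hl : l.Prime) (h5 : 5 ≤ l) (hcore : Cor22.AdmitsCore P) (h2 : Cor22.CondP2 P l)
    (h5' : Cor22.CondP5 P l) (h6 : Cor22.CondP6 P l) (h4d : 4 * (Cor22.dmod P : ℝ) ≤ (l : ℝ) + 5)
    {p₀ : ℕ} [Fact p₀.Prime] {V W : HeightOneSpectrum (𝓞 P.F)} (hV : V ∈ placesOver P.F p₀) (hWp : W ∈ placesOver P.F p₀)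
    (hVb : V ∈ Cor22.badPlacesAvoid P {2, l})
    (hne : W ∈ Cor22.badPlacesAvoid P {2, l} →
      (ord P.F V (Cor22.jInv P.x) : ℝ) * logNorm P.F V / (localDegree P.F V : ℝ) ≠
        (ord P.F W (Cor22.jInv P.x) : ℝ) * logNorm P.F W / (localDegree P.F W : ℝ))
    (W₀ : Finset ℕ) (hW : ∀ p ∈ W₀, p.Prime)
    (hω : ∀ p ∈ W₀, 0 < ∑ V ∈ Finset.univ.filter
        (fun V : placesOver ↥(IntermediateField.adjoin ℚ ({Cor22.jInv P.x} : Set P.F)) p =>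
          ¬ (ord _ V.1 (Cor22.jMod P) < 0 ∧ ((2 : ℕ) : 𝓞 _) ∉ V.1.asIdeal ∧ ((l : ℕ) : 𝓞 _) ∉ V.1.asIdeal)),
        weight _ V.1) :
    ∑ p ∈ W₀, (1 / (2 * (l : ℝ)) * ∑ V : placesOver ↥(IntermediateField.adjoin ℚ ({Cor22.jInv P.x} : Set P.F)) p,
        (if ord _ V.1 (Cor22.jMod P) < 0 ∧ ((2 : ℕ) : 𝓞 _) ∉ V.1.asIdeal ∧ ((l : ℕ) : 𝓞 _) ∉ V.1.asIdeal then
          weight _ V.1 * (((-ord _ V.1 (Cor22.jMod P) : ℤ) : ℝ) * logNorm _ V.1 / (localDegree _ V.1 : ℝ))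
         else 0)) *
      ((l : ℝ) * ((l : ℝ) + 1) / 12
        - 4 * (1 - ∑ V ∈ Finset.univ.filter
              (fun V : placesOver ↥(IntermediateField.adjoin ℚ ({Cor22.jInv P.x} : Set P.F)) p =>
                ¬ (ord _ V.1 (Cor22.jMod P) < 0 ∧ ((2 : ℕ) : 𝓞 _) ∉ V.1.asIdeal ∧ ((l : ℕ) : 𝓞 _) ∉ V.1.asIdeal)),
              weight _ V.1) /
          (((l : ℝ) - 1) * (∑ V ∈ Finset.univ.filter
              (fun V : placesOver ↥(IntermediateField.adjoin ℚ ({Cor22.jInv P.x} : Set P.F)) p =>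
                ¬ (ord _ V.1 (Cor22.jMod P) < 0 ∧ ((2 : ℕ) : 𝓞 _) ∉ V.1.asIdeal ∧ ((l : ℕ) : 𝓞 _) ∉ V.1.asIdeal)),
              weight _ V.1) ^ 3)) ≤
      (4 * (Cor22.dmod P : ℝ) - 1 + 3 * (Cor22.dmod P : ℝ) / l) * (P.logDiff + Cor22.logCondAvoid P {2, l})
        + ((l : ℝ) + 5 - 4 * (Cor22.dmod P : ℝ)) / (4 * (l : ℝ)) * Cor22.logCondAvoid P {2, l}
        + ((l : ℝ) + 1) / 4 * (2 * Real.log l + 52 + 20 / 3 * Real.log (((2 ^ 12 * 3 ^ 3 * 5 * Cor22.dmod P : ℕ) : ℝ) * (l : ℝ))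
          * (Nat.primeCounting (2 ^ 12 * 3 ^ 3 * 5 * Cor22.dmod P * l) : ℝ)) := by
  obtain ⟨T⟩ := Summit.ABC.ABC.Theorems.ThetaPartII.stub_thetaData P hP l hl h5 hcore h2 h5' h6
  have hns := not_slotConstant_of_unequalHeightsPoint T hV hWp hVb hne
  have hT := hreg P hP l hl h5 hcore h2 h5' h6 T hns
  have hl0 : (0 : ℝ) < (l : ℝ) := Nat.cast_pos.mpr hl.pos
  have h := pointMixedShare_add_mulNdeg_le_of_hullEstimateOf T hT W₀ hW hω
  have hG := T.ndeg_differentDivisor_ge hl.pos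
  exact le_slack_of_add_gain_le' hl0 (by ring) hG h4d h

/-- **SHARP NECESSITY FROM `hreg` WITHOUT THE GALOIS-IMAGE CONDITION**: for every compactly bounded `K_V` there is `H_K` such that the slack
inequality of `pointMixedShare_le_slack_of_hreg` holds at every `λ ∈ K_V ∩ U_P` with a mixed pair, every prime `l ≥ 7` with (P2), (P5),
`4·d_mod ≤ l+5`, «admits a core» and `H_K < log(q^∀(λ))` ((P6) by the tree's PROVED (P4) ⇒ (P6), `Cor22.condP6_of_seven_le`, abc-iut-S-d1).
Nothing asserted about any point; no side taken. [cite: Mochizuki2012, IUTchIV Cor. 2.2 (ii) proof (P4)–(P6) p. 45–46]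
[claim: Mochizuki2012, status: disputed] -/
theorem pointMixedShare_le_slack_eventually_of_hreg
    (hreg : ∀ P : NFPoint, P ∈ UP → ∀ l : ℕ, l.Prime → 5 ≤ l →
      Cor22.AdmitsCore P → Cor22.CondP2 P l → Cor22.CondP5 P l → Cor22.CondP6 P l →
      ∀ T : Cor22.ThetaVolumeDatumAt P l,
        (letI := T.instFieldF; letI := T.instNumberFieldF; letI := T.instAlgebraF; letI := T.instFieldK
         letI := T.instNumberFieldK; letI := T.instAlgebraK; letI := T.instFieldFbar; letI := T.instAlgebraFbar
         letI := T.instAlgebraKFbar; letI := T.instIsElliptic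
         ¬ (∀ p ∈ T.I.supportPrimes, ∀ v w : placesOver (fieldOfModuli T.E) p,
            (Summit.ABC.IUTFork.DHData.ofInput T.I).logQloc p v = (Summit.ABC.IUTFork.DHData.ofInput T.I).logQloc p w)) →
        T.HullEstimateOf
          (((l : ℝ) + 1) / 4 *
            ((1 + 12 * (Cor22.dmod P : ℝ) / l) * (P.logDiff + Cor22.logCondAvoid P {2, l})
              + 2 * Real.log l + 52
              + 20 / 3 * Real.log (((2 ^ 12 * 3 ^ 3 * 5 * Cor22.dmod P : ℕ) : ℝ) * (l : ℝ))
                * (Nat.primeCounting (2 ^ 12 * 3 ^ 3 * 5 * Cor22.dmod P * l) : ℝ))))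
    (D : CBData) :
    ∃ HK : ℝ, ∀ P : NFPoint, P ∈ D.toSet → P ∈ UP → ∀ l : ℕ, l.Prime → 7 ≤ l →
      Cor22.AdmitsCore P → Cor22.CondP2 P l → Cor22.CondP5 P l → 4 * (Cor22.dmod P : ℝ) ≤ (l : ℝ) + 5 →
      HK < Cor22.logQForall P →
      ∀ (p₀ : ℕ) [Fact p₀.Prime] (V W : HeightOneSpectrum (𝓞 P.F)), V ∈ placesOver P.F p₀ → W ∈ placesOver P.F p₀ →
        V ∈ Cor22.badPlacesAvoid P {2, l} →
        (W ∈ Cor22.badPlacesAvoid P {2, l} →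
          (ord P.F V (Cor22.jInv P.x) : ℝ) * logNorm P.F V / (localDegree P.F V : ℝ) ≠
            (ord P.F W (Cor22.jInv P.x) : ℝ) * logNorm P.F W / (localDegree P.F W : ℝ)) →
      ∀ W₀ : Finset ℕ, (∀ p ∈ W₀, p.Prime) →
        (∀ p ∈ W₀, 0 < ∑ V ∈ Finset.univ.filter
          (fun V : placesOver ↥(IntermediateField.adjoin ℚ ({Cor22.jInv P.x} : Set P.F)) p =>
            ¬ (ord _ V.1 (Cor22.jMod P) < 0 ∧ ((2 : ℕ) : 𝓞 _) ∉ V.1.asIdeal ∧ ((l : ℕ) : 𝓞 _) ∉ V.1.asIdeal)),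
          weight _ V.1) →
      ∑ p ∈ W₀, (1 / (2 * (l : ℝ)) * ∑ V : placesOver ↥(IntermediateField.adjoin ℚ ({Cor22.jInv P.x} : Set P.F)) p,
          (if ord _ V.1 (Cor22.jMod P) < 0 ∧ ((2 : ℕ) : 𝓞 _) ∉ V.1.asIdeal ∧ ((l : ℕ) : 𝓞 _) ∉ V.1.asIdeal then
            weight _ V.1 * (((-ord _ V.1 (Cor22.jMod P) : ℤ) : ℝ) * logNorm _ V.1 / (localDegree _ V.1 : ℝ))
           else 0)) *
        ((l : ℝ) * ((l : ℝ) + 1) / 12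
          - 4 * (1 - ∑ V ∈ Finset.univ.filter
                (fun V : placesOver ↥(IntermediateField.adjoin ℚ ({Cor22.jInv P.x} : Set P.F)) p =>
                  ¬ (ord _ V.1 (Cor22.jMod P) < 0 ∧ ((2 : ℕ) : 𝓞 _) ∉ V.1.asIdeal ∧ ((l : ℕ) : 𝓞 _) ∉ V.1.asIdeal)),
                weight _ V.1) /
            (((l : ℝ) - 1) * (∑ V ∈ Finset.univ.filter
                (fun V : placesOver ↥(IntermediateField.adjoin ℚ ({Cor22.jInv P.x} : Set P.F)) p =>
                  ¬ (ord _ V.1 (Cor22.jMod P) < 0 ∧ ((2 : ℕ) : 𝓞 _) ∉ V.1.asIdeal ∧ ((l : ℕ) : 𝓞 _) ∉ V.1.asIdeal)),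
                weight _ V.1) ^ 3)) ≤
        (4 * (Cor22.dmod P : ℝ) - 1 + 3 * (Cor22.dmod P : ℝ) / l) * (P.logDiff + Cor22.logCondAvoid P {2, l})
          + ((l : ℝ) + 5 - 4 * (Cor22.dmod P : ℝ)) / (4 * (l : ℝ)) * Cor22.logCondAvoid P {2, l}
          + ((l : ℝ) + 1) / 4 * (2 * Real.log l + 52 + 20 / 3 * Real.log (((2 ^ 12 * 3 ^ 3 * 5 * Cor22.dmod P : ℕ) : ℝ) * (l : ℝ))
            * (Nat.primeCounting (2 ^ 12 * 3 ^ 3 * 5 * Cor22.dmod P * l) : ℝ)) := by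
  obtain ⟨HK, hHK⟩ := Cor22.condP6_of_seven_le D
  refine ⟨HK, fun P hPD hP l hl h7 hcore h2 h5' h4d hh p₀ _ V W hV hWp hVb hne W₀ hW hω => ?_⟩
  have h5 : 5 ≤ l := le_trans (by norm_num) h7
  have h6 : Cor22.CondP6 P l := hHK P hPD hP l hl h7 h2 h5' hh
  exact pointMixedShare_le_slack_of_hreg hreg hP hl h5 hcore h2 h5' h6 h4d hV hWp hVb hne W₀ hW hω

end PointDict

end Summit.ABC.IUTFork

end
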